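import Summits.QuantumFields.YangMills.Theses.BalabanUVNodes

/-!
# `P0Content` ⟨stmt-QuantumFields-26900⟩ — LINE-FIRST SKELETON `p0_content` (line-writer seat `linewriter-ym-nodeo-1` g0, operator priority28, 2026-08-31)
# route `route-QuantumFields-BalabanUVNodes` (rev 38) · support item (rank 9) · sources Balaban1985Variational, Balaban1985PropagatorsRG

THE ITEM AS THE CRUX CONSUMES IT.  `P0Content` (node00-def-Y g36's text (B) v3, bytes `P0ContentB_v3.sig.txt` sha16 c39b0bf35b595c53, probe ✓p816225, CRIT-1 g36 J1′ PASS)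
is LITERALLY a four-fold conjunction `C1 ∧ C2 ∧ C3 ∧ C4` of CLOSED sentences over PINNED record names (`K0RecordFormatNames.recordK₀ ∕ thetaFill ∕ recordW ∕ recordBgField`,
`Node00.UkExists ∕ UniqueUkOrbit ∕ UkSel ∕ bgReg ∕ avOfRecord ∕ Space115Lit ∕ evLit ∕ frakGOfRecordAtBgFlat ∕ QflatOfRecord ∕ laplaceAOfRecord`); it is the antecedent-supplier
of the port rows ⟨27930⟩ `PortRecordRepresentationS1` (A11 = C1) and ⟨26648⟩ `PortZeroInputSplitZD`, i.e. the «P0 = [15] Theorem 1 + Prop. 6∕8 at the record» package of NODE O.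
The natural line is therefore the CONJUNCT CUT: four named stubs, one per conjunct, texts VERBATIM (fully qualified, byte-for-byte the route file's conjuncts), and the
composition `⟨C1, C2, C3, C4⟩`.  Each stub is independently closable `--supports stmt-QuantumFields-26900` and independently refutable; no constant is shared across conjuncts
(each conjunct fixes its own thresholds first), so the cut loses nothing — this is the one decomposition of this item with a `rfl` seam.

STUBS (4; tags in the card `p0_content.md`): C1 `stub_ukExistsUniqueOrbitAtRecord` [print: [15] Thm 1 (8)(9), Prop. 7; tree partials N07] · C2 `stub_bgFieldAnalyticAtRecord`
[print: [15] Prop. 6, [14] (2.20)–(2.22); research glue chart ⇒ record map] · C3 `stub_lieChart115AtRecord` [print (115)–(117) + research bookkeeping; HARDEST] ·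
C4 `stub_frakGNorm117BoundAtRecord` [print-far: [B9] (3.153)∕Thm 3.7 random-walk bounds; tree: gauge invariance of the norm ✓].
EXACTLY FOUR `sorry`s (the four stubs); EXACTLY ONE theorem concludes the crux BY NAME (`p0Content_of_stubs`); `P0Content_conj_iff` certifies (kernel, `Iff.rfl`) that the
four stub texts ARE the item's conjuncts.

HONEST LABEL.  A skeleton is SUPPLY FOR HANDS, not progress: nothing of [15]∕[14]∕[B9] is proved here; `P0Content` stays OPEN (0∕4); NODE O is not advanced; the route's
`closes` reaches only the CONDITIONAL finite-𝕋⁴ rung `BalabanLadder.UV` (R4) at fixed `ε = L^(−K)`; NOT ℝ⁴, NOT OS axioms, NOT a mass gap, NOT Clay — the Yang–Mills mass gap is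
NOT proved by any of this.  [15] = Balaban1985Variational (Commun. Math. Phys. 102, 277–309): Thm 1 (8),(9) p.279, Prop. 6 p.297, Prop. 7 p.299, Prop. 8 ∕ (115)–(117) p.304;
[14] = Balaban1985PropagatorsRG (2.20)–(2.22); [B9] = Balaban1985BackgroundPropagators (3.34), (3.153), Thm 3.7.
-/

namespace Summit.QuantumFields.YangMills.Theses.BalabanUVNodes.P0ContentSkeletonV1

/-! ## §1. The four stubs = the four conjuncts of `P0Content`, VERBATIM (fully qualified; no local copies of any letter) -/

/-- **stub C1 — [15] Theorem 1 (8)+(9) AT THE RECORD (E ∧ U)**: existence of the minimiser `U_k` of the constrained variational problem and uniqueness of its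
residual-gauge orbit, at `N = 2`, torus `K = recordK₀ F Mc k + n`, level `k + 1`, regularity `ε = a₀`, on `PlaqSmall ε₁ V` (`0 < ε₁ ≤ a₁`, `B₃ ε₁ ≤ a₀`), under the
CEILING-FIRST prefix `∃ aS > 0` fixed before `Mc, B₃, a₀, a₁`.  PRINT: [Balaban1985Variational] Thm 1 (8),(9) p.279, Prop. 7 p.299 (uniqueness), Sect. F pp.300–305
(induction on `k`).  Tree supply: `BalabanUVNodesN07DirectMethodInduction` (UkExists ⟸ «closed-class minimisers are interior», level 1 outright, level k+1 from level k),
`BalabanUVNodesN07CritCfgAxOfRecordClauses`, `BalabanUVNodesN07P0FixedPointIsRecordMinimiserCentred` (UniqueUkOrbit from the P0 scheme tokens).  Size L. -/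
theorem stub_ukExistsUniqueOrbitAtRecord :
    ∀ F : Literature.MathematicalPhysics.QuantumFieldTheory.Balaban1983to89.T4Continuum.T4Family, ∃ aS : ℝ, 0 < aS ∧ ∀ (Mc : ℕ) (B₃ a₀ a₁ : ℝ), Summit.QuantumFields.YangMills.Theorems.K0RecordFormatNames.McGuard F Mc → 2 * (F.L : ℝ) ^ 2 ≤ B₃ → 0 < a₀ → 0 < a₁ → a₀ ≤ aS → a₁ ≤ aS → ∀ ε₁ : ℝ, 0 < ε₁ → ε₁ ≤ a₁ → B₃ * ε₁ ≤ a₀ → ∀ (k n : ℕ) (V : Literature.MathematicalPhysics.QuantumFieldTheory.Balaban1983to89.GaugeField (F.P (Summit.QuantumFields.YangMills.Theorems.K0RecordFormatNames.recordK₀ F Mc k + n)) (k + 1) (Literature.MathematicalPhysics.QuantumFieldTheory.Balaban1983to89.Node00.SU 2)), Literature.MathematicalPhysics.QuantumFieldTheory.Balaban1983to89.PlaqSmall ε₁ V → Literature.MathematicalPhysics.QuantumFieldTheory.Balaban1983to89.Node00.UkExists F 2 (Summit.QuantumFields.YangMills.Theorems.K0RecordFormatNames.recordK₀ F Mc k +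 n) (k + 1) a₀ V ∧ Literature.MathematicalPhysics.QuantumFieldTheory.Balaban1983to89.Node00.UniqueUkOrbit F 2 (Summit.QuantumFields.YangMills.Theorems.K0RecordFormatNames.recordK₀ F Mc k + n) (k + 1) a₀ V := by
  sorry

/-- **stub C2 — [14] (2.20)∕[15] Prop. 6: REAL-ANALYTICITY OF THE BACKGROUND FIELD OF RECORD in the fluctuation variable `B` at `B = 0`** (matrix entries of
`recordBgField F θ k K B b : SU(2)`, `θ = thetaFill F a₀ ε₂₉`, torus `K = recordK₀ F Mc k + n`), under the ceiling-first prefix `∃ aS > 0, ∀ Mc a₀, McGuard → 0 < a₀ ≤ aS`.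
PRINT: [Balaban1985Variational] Prop. 6 p.297 (the fixed point `A⋆(V)` is analytic in `V`), [Balaban1985PropagatorsRG] = [14] (2.20)–(2.22) p.31 (analytic dependence of
`U_k(V)` on the small field).  Tree supply: `BalabanUVNodesPortS1Chart`, `BalabanUVNodesPortU8Linearisation`, `BalabanUVNodesK0AxTangentSocketPsi` (chart-level analyticity);
the composition «chart analytic ⇒ `recordBgField` analytic» is the research glue (the record's `recordBgField` is a `Classical.choose`-free named map only on the
uniqueness domain — C1's U feeds it).  Size M–L. -/
theorem stub_bgFieldAnalyticAtRecord :
    ∀ F : Literature.MathematicalPhysics.QuantumFieldTheory.Balaban1983to89.T4Continuum.T4Family, ∃ aS : ℝ, 0 < aS ∧ ∀ (Mc : ℕ) (a₀ : ℝ), Summit.QuantumFields.YangMills.Theorems.K0RecordFormatNames.McGuard F Mc → 0 < a₀ → a₀ ≤ aS → ∀ (k n : ℕ) (ε₂₉ : ℝ), 0 < ε₂₉ → letI θ := Summit.QuantumFields.YangMills.Theorems.K0RecordFormatNames.thetaFill F a₀ ε₂₉; letI := θ.instVβ₁; letI := θ.instVβ₂; letI := θ.instιβ; AnalyticAt ℝ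 (fun B : Summit.QuantumFields.YangMills.Theorems.K0RecordFormatNames.recordW F a₀ ε₂₉ k (Summit.QuantumFields.YangMills.Theorems.K0RecordFormatNames.recordK₀ F Mc k + n) => fun (b : Literature.MathematicalPhysics.QuantumFieldTheory.Balaban1983to89.PBond (F.P (Summit.QuantumFields.YangMills.Theorems.K0RecordFormatNames.recordK₀ F Mc k + n)) 0) (i i' : Fin 2) => ((Summit.QuantumFields.YangMills.Theorems.K0RecordFormatNames.recordBgField F θ k (Summit.QuantumFields.YangMills.Theorems.K0RecordFormatNames.recordK₀ F Mc k + n) B b : Literature.MathematicalPhysics.QuantumFieldTheory.Balaban1983to89.Node00.SU 2) : Matrix (Fin 2) (Fin 2) ℂ) i i') 0 := by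
  sorry

/-- **stub C3 — [15] (1.15)∕(115)–(117): THE LIE-ALGEBRA CHART OF THE SELECTOR OF RECORD** — on `PlaqSmall ε₁ V`, for every background `U₀ ∈ bgReg` of `V` within `C₁ ε₁`
of the block average, the selector `UkSel … V` is, up to a gauge transformation `u`, `exp(i X) · U₀` with `X` in the (115)-space `Node00.Space115Lit`, Hermitian, trace-free,
`‖X‖ ≤ B₁ (B₃ (1 + 4 C₁) + C₁) ε₁`; constants `B₁` first, then `aS` after `Mc, B₃, C₁`.  PRINT: [Balaban1985Variational] (115)–(117) p.304, Prop. 8 p.304, Thm 1 (9) p.279.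
Tree supply: `BalabanUVNodesK0AxTangentSocketOntoModGauge` (the `_modGauge` receipts at the def-Y junction), `BalabanUVNodesN07ConstraintLetterTangent`,
`BalabanUVNodesN07Delta2OfRecordExists`, `BalabanUVNodesC44IterMhAtRecord` (the (115)-space letters and the contraction).  RESEARCH part: the selector-level
statement with the explicit `(1 + 4 C₁)` bookkeeping is the cell's own reading (director-ym №528).  Size L (hardest). -/
theorem stub_lieChart115AtRecord :
    ∀ F : Literature.MathematicalPhysics.QuantumFieldTheory.Balaban1983to89.T4Continuum.T4Family, ∃ B₁ : ℝ, 0 < B₁ ∧ ∀ (Mc : ℕ) (B₃ C₁ : ℝ), Summit.QuantumFields.YangMills.Theorems.K0RecordFormatNames.McGuard F Mc → 2 * (F.L : ℝ) ^ 2 ≤ B₃ → 1 ≤ C₁ → ∃ aS : ℝ, 0 < aS ∧ ∀ (a₀ ε₁ : ℝ), 0 < ε₁ → ε₁ ≤ aS → B₃ * ε₁ ≤ a₀ → a₀ ≤ aS → ∀ (k n : ℕ) (V : Literature.MathematicalPhysics.QuantumFieldTheory.Balaban1983to89.GaugeField (F.P (Summit.QuantumFields.YangMills.Theorems.K0RecordFormatNames.recordK₀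 F Mc k + n)) (k + 1) (Literature.MathematicalPhysics.QuantumFieldTheory.Balaban1983to89.Node00.SU 2)), Literature.MathematicalPhysics.QuantumFieldTheory.Balaban1983to89.PlaqSmall ε₁ V → ∀ U₀ : Literature.MathematicalPhysics.QuantumFieldTheory.Balaban1983to89.GaugeField (F.P (Summit.QuantumFields.YangMills.Theorems.K0RecordFormatNames.recordK₀ F Mc k + n)) 0 (Literature.MathematicalPhysics.QuantumFieldTheory.Balaban1983to89.Node00.SU 2), U₀ ∈ Literature.MathematicalPhysics.QuantumFieldTheory.Balaban1983to89.Node00.bgReg F 2 (Summit.QuantumFields.YangMills.Theorems.K0RecordFormatNames.recordK₀ F Mc k + n) (k + 1) (C₁ * B₃ * ε₁) → (∀ c : Literature.MathematicalPhysics.QuantumFieldTheory.Balaban1983to89.PBond (F.P (Summit.QuantumFields.YangMills.Theorems.K0RecordFormatNames.recordK₀ F Mc k + n)) (k + 1), Literature.MathematicalPhysics.QuantumFieldTheory.Balaban1983to89.GaugeGroup.dist1 (Literature.MathematicalPhysics.QuantumFieldTheory.Balaban1983to89.Averaging.iter (Literature.MathematicalPhysics.QuantumFieldTheory.Balaban1983to89.Node00.avOfRecord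 F 2 (Summit.QuantumFields.YangMills.Theorems.K0RecordFormatNames.recordK₀ F Mc k + n)) (k + 1) U₀ c * (V c)⁻¹) < C₁ * ε₁) → haveI := Literature.MathematicalPhysics.QuantumFieldTheory.Balaban1983to89.Node00.factL F; haveI := Literature.MathematicalPhysics.QuantumFieldTheory.Balaban1983to89.Node00.factEta F (Summit.QuantumFields.YangMills.Theorems.K0RecordFormatNames.recordK₀ F Mc k + n) (k + 1); letI : NormedAddCommGroup (Matrix (Fin 2) (Fin 2) ℂ) := Matrix.instL2OpNormedAddCommGroup; letI : NormedSpace ℂ (Matrix (Fin 2) (Fin 2) ℂ) := Matrix.instL2OpNormedSpace; ∃ X : Literature.MathematicalPhysics.QuantumFieldTheory.Balaban1983to89.Node00.Space115Lit F 2 (Summit.QuantumFields.YangMills.Theorems.K0RecordFormatNames.recordK₀ F Mc k + n) (k + 1) (fun _ => Set.univ) U₀, ‖X‖ ≤ B₁ * (B₃ * (1 + 4 * C₁) + C₁) * ε₁ ∧ (∀ b : Literature.MathematicalPhysics.QuantumFieldTheory.Balaban1983to89.PBond (F.P (Summit.QuantumFields.YangMills.Theorems.K0RecordFormatNames.recordK₀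 F Mc k + n)) 0, (Literature.MathematicalPhysics.QuantumFieldTheory.Balaban1983to89.Node00.evLit F 2 (Summit.QuantumFields.YangMills.Theorems.K0RecordFormatNames.recordK₀ F Mc k + n) (k + 1) (fun _ => Set.univ) U₀ X b).IsHermitian ∧ (Literature.MathematicalPhysics.QuantumFieldTheory.Balaban1983to89.Node00.evLit F 2 (Summit.QuantumFields.YangMills.Theorems.K0RecordFormatNames.recordK₀ F Mc k + n) (k + 1) (fun _ => Set.univ) U₀ X b).trace = 0) ∧ ∃ u : Literature.MathematicalPhysics.QuantumFieldTheory.Balaban1983to89.GaugeTransf (F.P (Summit.QuantumFields.YangMills.Theorems.K0RecordFormatNames.recordK₀ F Mc k + n)) 0 (Literature.MathematicalPhysics.QuantumFieldTheory.Balaban1983to89.Node00.SU 2), ∀ b : Literature.MathematicalPhysics.QuantumFieldTheory.Balaban1983to89.PBond (F.P (Summit.QuantumFields.YangMills.Theorems.K0RecordFormatNames.recordK₀ F Mc k + n)) 0, ((Literature.MathematicalPhysics.QuantumFieldTheory.Balaban1983to89.GaugeField.gaugeAct u (Literature.MathematicalPhysics.QuantumFieldTheory.Balaban1983to89.Node00.UkSel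 F 2 (Summit.QuantumFields.YangMills.Theorems.K0RecordFormatNames.recordK₀ F Mc k + n) (k + 1) a₀ V) b : Literature.MathematicalPhysics.QuantumFieldTheory.Balaban1983to89.Node00.SU 2) : Matrix (Fin 2) (Fin 2) ℂ) = NormedSpace.exp (Complex.I • Literature.MathematicalPhysics.QuantumFieldTheory.Balaban1983to89.Node00.evLit F 2 (Summit.QuantumFields.YangMills.Theorems.K0RecordFormatNames.recordK₀ F Mc k + n) (k + 1) (fun _ => Set.univ) U₀ X b) * ((U₀ b : Literature.MathematicalPhysics.QuantumFieldTheory.Balaban1983to89.Node00.SU 2) : Matrix (Fin 2) (Fin 2) ℂ) := by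
  sorry

/-- **stub C4 — [15] (117)∕[B9] (3.153): THE UNIFORM BOUND `‖𝔊(U₀)‖ ≤ B₀` ON def-Y's HANDLE `frakGOfRecordAtBgFlat`** at the FLAT gauge letter, for every
`U₀ ∈ bgReg` within `δ ≤ δ₀` of a configuration, constants `B₀ δ₀` depending on `(F, a)` only, uniformly in `Mc, k, n`.  PRINT: [Balaban1985Variational] (117) p.304;
[Balaban1985BackgroundPropagators] = [B9] Thm 3.7 ∕ (3.153) p.426 (the propagator bounds), p.398 («all these inequalities are gauge invariant»).  Tree supply:
`BalabanUVNodesN07FrakGOfRecordGaugeCovariance` (★★★ the (117)-norm is GAUGE INVARIANT — C4 is a property of the orbit, so it may be proved in a convenient gauge),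
`BalabanUVNodesN07FrakGOfRecordSliceFlat`, `…FrakGOfRecordReality`, `…FrakGOfRecordTraceSectors`, `…LaplaceAOfRecordFlatPos` (the `hpos`∕`hQ` side conditions),
`Literature…Node00.BgRemainderOfRecord` ∕ `BgGaugeLetterOfRecord` (the letters).  The bound itself = [B9]'s random-walk expansion at the record: PRINT-FAR (not in tree).  Size L. -/
theorem stub_frakGNorm117BoundAtRecord :
    ∀ (F : Literature.MathematicalPhysics.QuantumFieldTheory.Balaban1983to89.T4Continuum.T4Family) (a : ℝ), 0 < a → ∃ B₀ δ₀ : ℝ, 0 < B₀ ∧ 0 < δ₀ ∧ ∀ Mc : ℕ, Summit.QuantumFields.YangMills.Theorems.K0RecordFormatNames.McGuard F Mc → ∀ (k n : ℕ) (δ : ℝ), 0 < δ → δ ≤ δ₀ → ∀ U₀ : Literature.MathematicalPhysics.QuantumFieldTheory.Balaban1983to89.GaugeField (F.P (Summit.QuantumFields.YangMills.Theorems.K0RecordFormatNames.recordK₀ F Mc k + n)) 0 (Literature.MathematicalPhysics.QuantumFieldTheory.Balaban1983to89.Node00.SU 2), U₀ ∈ Literature.MathematicalPhysics.QuantumFieldTheory.Balaban1983to89.Node00.bgReg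 F 2 (Summit.QuantumFields.YangMills.Theorems.K0RecordFormatNames.recordK₀ F Mc k + n) (k + 1) δ → haveI := Literature.MathematicalPhysics.QuantumFieldTheory.Balaban1983to89.Node00.factL F; haveI := Literature.MathematicalPhysics.QuantumFieldTheory.Balaban1983to89.Node00.factEta F (Summit.QuantumFields.YangMills.Theorems.K0RecordFormatNames.recordK₀ F Mc k + n) (k + 1); letI : NormedAddCommGroup (Matrix (Fin 2) (Fin 2) ℂ) := Matrix.instL2OpNormedAddCommGroup; letI : NormedSpace ℂ (Matrix (Fin 2) (Fin 2) ℂ) := Matrix.instL2OpNormedSpace; haveI : Fact (0 < Literature.MathematicalPhysics.QuantumFieldTheory.Balaban1983to89.Node00.c0Rec F (Summit.QuantumFields.YangMills.Theorems.K0RecordFormatNames.recordK₀ F Mc k + n) (k + 1)) := ⟨Literature.MathematicalPhysics.QuantumFieldTheory.Balaban1983to89.Node00.c0Rec_pos F (Summit.QuantumFields.YangMills.Theorems.K0RecordFormatNames.recordK₀ F Mc k + n) (k + 1)⟩; haveI := Literature.MathematicalPhysics.QuantumFieldTheory.Balaban1983to89.Node00.wBRec_fact F (Summit.QuantumFields.YangMills.Theorems.K0RecordFormatNames.recordK₀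 F Mc k + n) (k + 1); ∀ (hpos : ∀ x, x ≠ 0 → 0 < RCLike.re (inner ℂ x (Literature.MathematicalPhysics.QuantumFieldTheory.Balaban1983to89.Node00.laplaceAOfRecord F 2 (k + 1) U₀ (Literature.MathematicalPhysics.QuantumFieldTheory.Balaban1983to89.Node00.QOfRecord F 2 (k + 1) U₀) (Literature.MathematicalPhysics.QuantumFieldTheory.Balaban1983to89.Node00.QflatOfRecord F 2 (k + 1)) a x))) (hQ : Function.Surjective (Literature.MathematicalPhysics.QuantumFieldTheory.Balaban1983to89.Node00.QOfRecord F 2 (k + 1) U₀)), ‖Literature.MathematicalPhysics.QuantumFieldTheory.Balaban1983to89.Node00.frakGOfRecordAtBgFlat F 2 (Summit.QuantumFields.YangMills.Theorems.K0RecordFormatNames.recordK₀ F Mc k + n) (k + 1) (fun _ => Set.univ) U₀ a hpos hQ‖ ≤ B₀ := by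
  sorry

/-! ## §2. Kernel certificate: the stub texts ARE the item's conjuncts -/

/-- sanity (kernel, `Iff.rfl`): `P0Content` is literally the conjunction of the four stub statements, in this order. -/
theorem P0Content_conj_iff :
    Summit.QuantumFields.YangMills.Theses.BalabanUVNodes.P0Content ↔
      ((∀ F : Literature.MathematicalPhysics.QuantumFieldTheory.Balaban1983to89.T4Continuum.T4Family, ∃ aS : ℝ, 0 < aS ∧ ∀ (Mc : ℕ) (B₃ a₀ a₁ : ℝ), Summit.QuantumFields.YangMills.Theorems.K0RecordFormatNames.McGuard F Mc → 2 * (F.L : ℝ) ^ 2 ≤ B₃ → 0 < a₀ → 0 < a₁ → a₀ ≤ aS → a₁ ≤ aS → ∀ ε₁ : ℝ, 0 < ε₁ → ε₁ ≤ a₁ → B₃ * ε₁ ≤ a₀ → ∀ (k n : ℕ) (V : Literature.MathematicalPhysics.QuantumFieldTheory.Balaban1983to89.GaugeField (F.P (Summit.QuantumFields.YangMills.Theorems.K0RecordFormatNames.recordK₀ F Mc k + n)) (k + 1) (Literature.MathematicalPhysics.QuantumFieldTheory.Balaban1983to89.Node00.SU 2)), Literature.MathematicalPhysics.QuantumFieldTheory.Balaban1983to89.PlaqSmall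 ε₁ V → Literature.MathematicalPhysics.QuantumFieldTheory.Balaban1983to89.Node00.UkExists F 2 (Summit.QuantumFields.YangMills.Theorems.K0RecordFormatNames.recordK₀ F Mc k + n) (k + 1) a₀ V ∧ Literature.MathematicalPhysics.QuantumFieldTheory.Balaban1983to89.Node00.UniqueUkOrbit F 2 (Summit.QuantumFields.YangMills.Theorems.K0RecordFormatNames.recordK₀ F Mc k + n) (k + 1) a₀ V) ∧
       (∀ F : Literature.MathematicalPhysics.QuantumFieldTheory.Balaban1983to89.T4Continuum.T4Family, ∃ aS : ℝ, 0 < aS ∧ ∀ (Mc : ℕ) (a₀ : ℝ), Summit.QuantumFields.YangMills.Theorems.K0RecordFormatNames.McGuard F Mc → 0 < a₀ → a₀ ≤ aS → ∀ (k n : ℕ) (ε₂₉ : ℝ), 0 < ε₂₉ → letI θ := Summit.QuantumFields.YangMills.Theorems.K0RecordFormatNames.thetaFill F a₀ ε₂₉; letI := θ.instVβ₁; letI := θ.instVβ₂; letI := θ.instιβ; AnalyticAt ℝ (fun B : Summit.QuantumFields.YangMills.Theorems.K0RecordFormatNames.recordW F a₀ ε₂₉ k (Summit.QuantumFields.YangMills.Theorems.K0RecordFormatNames.recordK₀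 F Mc k + n) => fun (b : Literature.MathematicalPhysics.QuantumFieldTheory.Balaban1983to89.PBond (F.P (Summit.QuantumFields.YangMills.Theorems.K0RecordFormatNames.recordK₀ F Mc k + n)) 0) (i i' : Fin 2) => ((Summit.QuantumFields.YangMills.Theorems.K0RecordFormatNames.recordBgField F θ k (Summit.QuantumFields.YangMills.Theorems.K0RecordFormatNames.recordK₀ F Mc k + n) B b : Literature.MathematicalPhysics.QuantumFieldTheory.Balaban1983to89.Node00.SU 2) : Matrix (Fin 2) (Fin 2) ℂ) i i') 0) ∧
       (∀ F : Literature.MathematicalPhysics.QuantumFieldTheory.Balaban1983to89.T4Continuum.T4Family, ∃ B₁ : ℝ, 0 < B₁ ∧ ∀ (Mc : ℕ) (B₃ C₁ : ℝ), Summit.QuantumFields.YangMills.Theorems.K0RecordFormatNames.McGuard F Mc → 2 * (F.L : ℝ) ^ 2 ≤ B₃ → 1 ≤ C₁ → ∃ aS : ℝ, 0 < aS ∧ ∀ (a₀ ε₁ : ℝ), 0 < ε₁ → ε₁ ≤ aS → B₃ * ε₁ ≤ a₀ → a₀ ≤ aS → ∀ (k n : ℕ) (V : Literature.MathematicalPhysics.QuantumFieldTheory.Balaban1983to89.GaugeField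 (F.P (Summit.QuantumFields.YangMills.Theorems.K0RecordFormatNames.recordK₀ F Mc k + n)) (k + 1) (Literature.MathematicalPhysics.QuantumFieldTheory.Balaban1983to89.Node00.SU 2)), Literature.MathematicalPhysics.QuantumFieldTheory.Balaban1983to89.PlaqSmall ε₁ V → ∀ U₀ : Literature.MathematicalPhysics.QuantumFieldTheory.Balaban1983to89.GaugeField (F.P (Summit.QuantumFields.YangMills.Theorems.K0RecordFormatNames.recordK₀ F Mc k + n)) 0 (Literature.MathematicalPhysics.QuantumFieldTheory.Balaban1983to89.Node00.SU 2), U₀ ∈ Literature.MathematicalPhysics.QuantumFieldTheory.Balaban1983to89.Node00.bgReg F 2 (Summit.QuantumFields.YangMills.Theorems.K0RecordFormatNames.recordK₀ F Mc k + n) (k + 1) (C₁ * B₃ * ε₁) → (∀ c : Literature.MathematicalPhysics.QuantumFieldTheory.Balaban1983to89.PBond (F.P (Summit.QuantumFields.YangMills.Theorems.K0RecordFormatNames.recordK₀ F Mc k + n)) (k + 1), Literature.MathematicalPhysics.QuantumFieldTheory.Balaban1983to89.GaugeGroup.dist1 (Literature.MathematicalPhysics.QuantumFieldTheory.Balaban1983to89.Averaging.iter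 (Literature.MathematicalPhysics.QuantumFieldTheory.Balaban1983to89.Node00.avOfRecord F 2 (Summit.QuantumFields.YangMills.Theorems.K0RecordFormatNames.recordK₀ F Mc k + n)) (k + 1) U₀ c * (V c)⁻¹) < C₁ * ε₁) → haveI := Literature.MathematicalPhysics.QuantumFieldTheory.Balaban1983to89.Node00.factL F; haveI := Literature.MathematicalPhysics.QuantumFieldTheory.Balaban1983to89.Node00.factEta F (Summit.QuantumFields.YangMills.Theorems.K0RecordFormatNames.recordK₀ F Mc k + n) (k + 1); letI : NormedAddCommGroup (Matrix (Fin 2) (Fin 2) ℂ) := Matrix.instL2OpNormedAddCommGroup; letI : NormedSpace ℂ (Matrix (Fin 2) (Fin 2) ℂ) := Matrix.instL2OpNormedSpace; ∃ X : Literature.MathematicalPhysics.QuantumFieldTheory.Balaban1983to89.Node00.Space115Lit F 2 (Summit.QuantumFields.YangMills.Theorems.K0RecordFormatNames.recordK₀ F Mc k + n) (k + 1) (fun _ => Set.univ) U₀, ‖X‖ ≤ B₁ * (B₃ * (1 + 4 * C₁) + C₁) * ε₁ ∧ (∀ b : Literature.MathematicalPhysics.QuantumFieldTheory.Balaban1983to89.PBond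 (F.P (Summit.QuantumFields.YangMills.Theorems.K0RecordFormatNames.recordK₀ F Mc k + n)) 0, (Literature.MathematicalPhysics.QuantumFieldTheory.Balaban1983to89.Node00.evLit F 2 (Summit.QuantumFields.YangMills.Theorems.K0RecordFormatNames.recordK₀ F Mc k + n) (k + 1) (fun _ => Set.univ) U₀ X b).IsHermitian ∧ (Literature.MathematicalPhysics.QuantumFieldTheory.Balaban1983to89.Node00.evLit F 2 (Summit.QuantumFields.YangMills.Theorems.K0RecordFormatNames.recordK₀ F Mc k + n) (k + 1) (fun _ => Set.univ) U₀ X b).trace = 0) ∧ ∃ u : Literature.MathematicalPhysics.QuantumFieldTheory.Balaban1983to89.GaugeTransf (F.P (Summit.QuantumFields.YangMills.Theorems.K0RecordFormatNames.recordK₀ F Mc k + n)) 0 (Literature.MathematicalPhysics.QuantumFieldTheory.Balaban1983to89.Node00.SU 2), ∀ b : Literature.MathematicalPhysics.QuantumFieldTheory.Balaban1983to89.PBond (F.P (Summit.QuantumFields.YangMills.Theorems.K0RecordFormatNames.recordK₀ F Mc k + n)) 0, ((Literature.MathematicalPhysics.QuantumFieldTheory.Balaban1983to89.GaugeField.gaugeAct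 u (Literature.MathematicalPhysics.QuantumFieldTheory.Balaban1983to89.Node00.UkSel F 2 (Summit.QuantumFields.YangMills.Theorems.K0RecordFormatNames.recordK₀ F Mc k + n) (k + 1) a₀ V) b : Literature.MathematicalPhysics.QuantumFieldTheory.Balaban1983to89.Node00.SU 2) : Matrix (Fin 2) (Fin 2) ℂ) = NormedSpace.exp (Complex.I • Literature.MathematicalPhysics.QuantumFieldTheory.Balaban1983to89.Node00.evLit F 2 (Summit.QuantumFields.YangMills.Theorems.K0RecordFormatNames.recordK₀ F Mc k + n) (k + 1) (fun _ => Set.univ) U₀ X b) * ((U₀ b : Literature.MathematicalPhysics.QuantumFieldTheory.Balaban1983to89.Node00.SU 2) : Matrix (Fin 2) (Fin 2) ℂ)) ∧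
       (∀ (F : Literature.MathematicalPhysics.QuantumFieldTheory.Balaban1983to89.T4Continuum.T4Family) (a : ℝ), 0 < a → ∃ B₀ δ₀ : ℝ, 0 < B₀ ∧ 0 < δ₀ ∧ ∀ Mc : ℕ, Summit.QuantumFields.YangMills.Theorems.K0RecordFormatNames.McGuard F Mc → ∀ (k n : ℕ) (δ : ℝ), 0 < δ → δ ≤ δ₀ → ∀ U₀ : Literature.MathematicalPhysics.QuantumFieldTheory.Balaban1983to89.GaugeField (F.P (Summit.QuantumFields.YangMills.Theorems.K0RecordFormatNames.recordK₀ F Mc k + n)) 0 (Literature.MathematicalPhysics.QuantumFieldTheory.Balaban1983to89.Node00.SU 2), U₀ ∈ Literature.MathematicalPhysics.QuantumFieldTheory.Balaban1983to89.Node00.bgReg F 2 (Summit.QuantumFields.YangMills.Theorems.K0RecordFormatNames.recordK₀ F Mc k + n) (k + 1) δ → haveI := Literature.MathematicalPhysics.QuantumFieldTheory.Balaban1983to89.Node00.factL F; haveI := Literature.MathematicalPhysics.QuantumFieldTheory.Balaban1983to89.Node00.factEta F (Summit.QuantumFields.YangMills.Theorems.K0RecordFormatNames.recordK₀ F Mc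 k + n) (k + 1); letI : NormedAddCommGroup (Matrix (Fin 2) (Fin 2) ℂ) := Matrix.instL2OpNormedAddCommGroup; letI : NormedSpace ℂ (Matrix (Fin 2) (Fin 2) ℂ) := Matrix.instL2OpNormedSpace; haveI : Fact (0 < Literature.MathematicalPhysics.QuantumFieldTheory.Balaban1983to89.Node00.c0Rec F (Summit.QuantumFields.YangMills.Theorems.K0RecordFormatNames.recordK₀ F Mc k + n) (k + 1)) := ⟨Literature.MathematicalPhysics.QuantumFieldTheory.Balaban1983to89.Node00.c0Rec_pos F (Summit.QuantumFields.YangMills.Theorems.K0RecordFormatNames.recordK₀ F Mc k + n) (k + 1)⟩; haveI := Literature.MathematicalPhysics.QuantumFieldTheory.Balaban1983to89.Node00.wBRec_fact F (Summit.QuantumFields.YangMills.Theorems.K0RecordFormatNames.recordK₀ F Mc k + n) (k + 1); ∀ (hpos : ∀ x, x ≠ 0 → 0 < RCLike.re (inner ℂ x (Literature.MathematicalPhysics.QuantumFieldTheory.Balaban1983to89.Node00.laplaceAOfRecord F 2 (k + 1) U₀ (Literature.MathematicalPhysics.QuantumFieldTheory.Balaban1983to89.Node00.QOfRecord F 2 (k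 + 1) U₀) (Literature.MathematicalPhysics.QuantumFieldTheory.Balaban1983to89.Node00.QflatOfRecord F 2 (k + 1)) a x))) (hQ : Function.Surjective (Literature.MathematicalPhysics.QuantumFieldTheory.Balaban1983to89.Node00.QOfRecord F 2 (k + 1) U₀)), ‖Literature.MathematicalPhysics.QuantumFieldTheory.Balaban1983to89.Node00.frakGOfRecordAtBgFlat F 2 (Summit.QuantumFields.YangMills.Theorems.K0RecordFormatNames.recordK₀ F Mc k + n) (k + 1) (fun _ => Set.univ) U₀ a hpos hQ‖ ≤ B₀)) := Iff.rfl

/-! ## §3. Composition BY NAME -/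

/-- **★ THE SKELETON THEOREM — `P0Content` from the four registered stubs** (the form `ledger skeleton check` composes; the ONLY theorem of this file concluding the
crux BY NAME).  No `sorry` here; the seam is the anonymous constructor. -/
theorem p0Content_of_stubs : Summit.QuantumFields.YangMills.Theses.BalabanUVNodes.P0Content :=
  ⟨stub_ukExistsUniqueOrbitAtRecord, stub_bgFieldAnalyticAtRecord, stub_lieChart115AtRecord, stub_frakGNorm117BoundAtRecord⟩

end Summit.QuantumFields.YangMills.Theses.BalabanUVNodes.P0ContentSkeletonV1
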